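import Summits.CriticalPhenomena.PercolationContinuityZ3.Theorems.Transplant.FKConnectivityAllQAntipodalPolar
import HarnessLib

/-!
# Connectivity correlation inequalities for `φ_{w,q}`, every `q > 0` — the PAIR–APEX node:
# `{s ↔ t}` and `{z ↔ s} ∪ {z ↔ t}` are positively correlated (one conjecture node, its place between `AntipodalTPos` and `HubFKPos`)

Definitions + theorems file (`--supports stmt-CriticalPhenomena-4575`), census lineage `prim-bschramm-census` (gen 25) of the
post-continuity programme; builds on p205010 (kernel theorem, internal audit signed; external expert review pending).  One
`@[conjecture]` node (`PairApexFKPos`, NOT asserted); no named facts, no sorries; standard axioms.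

THE STATEMENT.  `PairApexUnder μ z s t`: `μ(s ↔ t)·μ(z ↔ s ∪ z ↔ t) ≤ μ(Ω)·μ((s ↔ t) ∩ (z ↔ s ∪ z ↔ t))` — the pair `{s,t}` being joined is
positively correlated with the apex `z` reaching the pair.  In the five-pattern law `m` of `{z,s,t}` this is exactly census gen 24's
`δ = m0·m4 − m1·(m2+m3) ≥ 0` (memo bschramm/FROM-census-g24-TWO-PATH-TRANSFER.md §10; theorem on 2-path pieces there); it implies
Ayyer–Linusson–Ravichandran's hub inequality (14)/(13) at the hubs `s` and `t` (`hubUnder_of_pairApexUnder`), and it follows from the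
weight-free antipodal statement of `…AntipodalPolar.lean` (`pairApexUnder_of_antipodalTOn`).  So the conjecture nodes line up as
**`AntipodalTPos → PairApexFKPos → HubFKPos`** (`pairApexFKPos_of_antipodalTPos`, `hubFKPos_of_pairApexFKPos`); for `q ≥ 1` the node
holds by FKG (`pairApexFK_of_one_le`).  EVIDENCE for `q < 1` (census gens 24–25): exact/float censuses of `δ ≥ 0` on all graphs with
`≤ 9` vertices at many palettes and `q` (2.1·10⁹ triple-tests, 0 violations) and — decisive for `≤ 8` vertices — the fiberwise integer
certificate of `…AntipodalPolar.lean`'s hypothesis on every graph with `≤ 8` vertices, which makes `PairApexUnder (φ_{w,q}) z s t` a theorem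
for every weight vector on `≤ 8` vertices and every `q > 0` (memo bschramm/FROM-census-g25-ANTIPODAL-T.md §5).
[cite: AyyerLinussonRavichandran2025, §7 eq. (13)–(15), Conj. 7.1 (p. 22)] [cite: Grimmett2006, Thm. (3.8) (q ≥ 1); §3.9 (p. 63)]
-/

noncomputable section

namespace Summit.CriticalPhenomena.PercolationContinuityZ3.Theorems

namespace FK

open MeasureTheory Set Literature.Probability.LatticeModels Literature.Probability.Percolation
open scoped Classical

variable {V : Type*}

/-! ### The node -/

/-- **Pair–apex positive correlation under `μ`**: `μ(s ↔ t)·μ(z ↔ s ∪ z ↔ t) ≤ μ(Ω)·μ((s ↔ t) ∩ (z ↔ s ∪ z ↔ t))`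
(homogeneous form).  For `μ = φ_{w,q}`, `q ≥ 1` this is FKG; conjectured for every `q > 0`.
[cite: AyyerLinussonRavichandran2025, §7 eq. (14) (p. 22)] [cite: Grimmett2006, Thm. (3.8); §3.9 (p. 63)] -/
def PairApexUnder (μ : Measure (BondConfig V)) (z s t : V) : Prop :=
  μ.real (openConn s t) * μ.real (openConn z s ∪ openConn z t) ≤
    μ.real univ * μ.real (openConn s t ∩ (openConn z s ∪ openConn z t))

variable [Fintype V]

/-- Pair–apex positive correlation for every `φ_{w,q}` on every `Fin n` at the cluster weight `q`.
[cite: AyyerLinussonRavichandran2025, §7 (p. 22)] -/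
def PairApexFK (q : ℝ) : Prop :=
  ∀ (n : ℕ) (w : Sym2 (Fin n) → unitInterval) (z s t : Fin n), PairApexUnder (rcMeasureW w q ∅) z s t

/-- **Pair–apex positive correlation for every `q > 0`.**  CONJECTURE-SHAPED STATEMENT, NOT asserted (census gen 24's `δ ≥ 0`;
evidence: exact censuses through 9 vertices and the fiberwise certificate through 8 vertices, census gens 24–25).  Implied by
`AntipodalTPos`, implies `HubFKPos`. [cite: AyyerLinussonRavichandran2025, §7 eq. (13)–(15) (p. 22)] [cite: Grimmett2006, §3.9 (p. 63)] -/
@[conjecture] def PairApexFKPos : Prop := ∀ q : ℝ, 0 < q → PairApexFK q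

/-! ### Its place in the chain of nodes -/

omit [Fintype V] in
/-- `{s ↔ t} ∩ ({z ↔ s} ∪ {z ↔ t}) = {z ↔ s} ∩ {t ↔ s}` (transitivity of `↔`). [folklore] -/
theorem openConn_inter_union_eq (z s t : V) :
    (openConn s t ∩ (openConn z s ∪ openConn z t) : Set (BondConfig V)) = openConn z s ∩ openConn t s := by
  ext ω
  simp only [Set.mem_inter_iff, Set.mem_union]
  constructor
  · rintro ⟨hst, hzs | hzt⟩
    · exact ⟨hzs, SimpleGraph.Reachable.symm hst⟩
    · exact ⟨SimpleGraph.Reachable.trans hzt (SimpleGraph.Reachable.symm hst), SimpleGraph.Reachable.symm hst⟩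
  · rintro ⟨hzs, hts⟩
    exact ⟨SimpleGraph.Reachable.symm hts, Or.inl hzs⟩

omit [Fintype V] in
/-- **Pair–apex ⇒ hub** for any finite measure: `μ(z ↔ s)·μ(t ↔ s) ≤ μ(Ω)·μ(z ↔ s ↔ t)` from the pair–apex inequality, because
`{z ↔ s} ⊆ {z ↔ s} ∪ {z ↔ t}`. [cite: AyyerLinussonRavichandran2025, §7 eq. (13)–(14) (p. 22)] -/
theorem hubUnder_of_pairApexUnder (μ : Measure (BondConfig V)) [IsFiniteMeasure μ] (z s t : V)
    (h : PairApexUnder μ z s t) : HubUnder μ z s t := by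
  unfold HubUnder
  unfold PairApexUnder at h
  rw [openConn_inter_union_eq] at h
  have hmono : μ.real (openConn z s) ≤ μ.real (openConn z s ∪ openConn z t) :=
    measureReal_mono Set.subset_union_left
  have hset : (openConn t s : Set (BondConfig V)) = openConn s t := by
    ext ω; exact ⟨fun h => SimpleGraph.Reachable.symm h, fun h => SimpleGraph.Reachable.symm h⟩
  have hts : μ.real (openConn t s) = μ.real (openConn s t) := by rw [hset]
  rw [hts]
  calc μ.real (openConn z s) * μ.real (openConn s t)
      ≤ μ.real (openConn z s ∪ openConn z t) * μ.real (openConn s t) :=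
        mul_le_mul_of_nonneg_right hmono measureReal_nonneg
    _ = μ.real (openConn s t) * μ.real (openConn z s ∪ openConn z t) := mul_comm _ _
    _ ≤ μ.real univ * μ.real (openConn z s ∩ openConn t s) := h

/-- **Antipodal nonnegativity ⇒ pair–apex** for every weight vector on `V` (= `real_conn_union_le_of_antipodalTOn`).
[cite: AyyerLinussonRavichandran2025, §7 (p. 22)] -/
theorem pairApexUnder_of_antipodalTOn (w : Sym2 V → unitInterval) {q : ℝ} (hq : 0 < q) (h : AntipodalTOn V q) (z s t : V) :
    PairApexUnder (rcMeasureW w q ∅) z s t :=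
  real_conn_union_le_of_antipodalTOn w hq h z s t

/-- `AntipodalTFK q → PairApexFK q`. [cite: AyyerLinussonRavichandran2025, §7 (p. 22)] -/
theorem pairApexFK_of_antipodalTFK {q : ℝ} (hq : 0 < q) (h : AntipodalTFK q) : PairApexFK q :=
  fun n w z s t => pairApexUnder_of_antipodalTOn w hq (h n) z s t

/-- `PairApexFK q → HubFK q`. [cite: AyyerLinussonRavichandran2025, §7 eq. (13)–(14) (p. 22)] -/
theorem hubFK_of_pairApexFK {q : ℝ} (hq : 0 < q) (h : PairApexFK q) : HubFK q := by
  intro n w o a b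
  haveI := isProbabilityMeasure_rcMeasureW w hq (∅ : Set (Fin n))
  exact hubUnder_of_pairApexUnder _ o a b (h n w o a b)

/-- **Node chain, first link**: `AntipodalTPos → PairApexFKPos`. [cite: AyyerLinussonRavichandran2025, §7 (p. 22)] -/
theorem pairApexFKPos_of_antipodalTPos (h : AntipodalTPos) : PairApexFKPos :=
  fun q hq => pairApexFK_of_antipodalTFK hq (h q hq)

/-- **Node chain, second link**: `PairApexFKPos → HubFKPos` (ALR (13)/(14) for every `q > 0`).
[cite: AyyerLinussonRavichandran2025, §7 eq. (13)–(15), Conj. 7.1 (p. 22)] -/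
theorem hubFKPos_of_pairApexFKPos (h : PairApexFKPos) : HubFKPos :=
  fun q hq => hubFK_of_pairApexFK hq (h q hq)

/-- **`q ≥ 1`: the pair–apex node holds by FKG** (both events are increasing). [cite: Grimmett2006, Thm. (3.8) (p. 39)] -/
theorem pairApexFK_of_one_le {q : ℝ} (hq : 1 ≤ q) : PairApexFK q := by
  intro n w z s t
  have hq0 : 0 < q := one_pos.trans_le hq
  haveI := isProbabilityMeasure_rcMeasureW w hq0 (∅ : Set (Fin n))
  unfold PairApexUnder
  rw [probReal_univ, one_mul]
  exact rcMeasureW_fkg w hq ∅ (isUpperSet_openConn s t) ((isUpperSet_openConn z s).union (isUpperSet_openConn z t))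

end FK

end Summit.CriticalPhenomena.PercolationContinuityZ3.Theorems
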